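import Mathlib.LinearAlgebra.Span.Basic
import Mathlib.RingTheory.Ideal.Span
import Mathlib.RingTheory.Ideal.Lattice

/-!
# Helper `helper_gcdShadow` of line `Sketch` (crux `SblfDescent.StepTwo`,
item stmt-SmoothPoincare4-18529): the `H₁`-shadow of the gluing defect

Pure `ℤ`-linear algebra.  On `H₁(Σ₂) = ℤ⁴` write
`ω(x, y) = x 0 * y 1 - x 1 * y 0 + x 2 * y 3 - x 3 * y 2` for the intersection form.  If the
round-curve class `c` is primitive (`ω(y, c) = 1` for some `y`), the lower gluing direction `γ`
lies in the fibre lattice (`ω(γ, c) = 0`), and `c, γ, c₁, …, c₄` span `ℤ⁴` (`H₁(X) = 0`), then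
the ideal generated by the `ω(cᵢ, c)` is all of `ℤ` (the Lefschetz cycles meet the round curve
with total gcd `1`).

Proof: the functional `x ↦ ω(x, c)` maps every generator of the span into the ideal
`I = (ω(c₁, c), …, ω(c₄, c))` (`ω(c, c) = 0`, `ω(γ, c) = 0` by hypothesis, `ω(cᵢ, c) ∈ I`), hence
(span induction) maps the whole span `= ⊤` into `I`; the witness `y` gives `1 ∈ I`.
-/

-- the prescribed namespace `Summit.<P>.<Sub>.…` duplicates `SmoothPoincare4` (P = Sub)
set_option linter.dupNamespace false

namespace Summit.SmoothPoincare4.SmoothPoincare4.Theorems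

/-- **`H₁`-shadow of the gluing defect (registered stub `helper_gcdShadow`).**  With
`ω(x, c) = x 0 * c 1 - x 1 * c 0 + x 2 * c 3 - x 3 * c 2`: if `ω(y, c) = 1` for some `y`,
`ω(γ, c) = 0`, and `c, γ, cs 0, …, cs 3` span `ℤ⁴`, then the ideal of `ℤ` generated by the
`ω(cs i, c)` is `⊤`. -/
theorem helper_gcdShadow : ∀ (c γ : Fin 4 → ℤ) (cs : Fin 4 → (Fin 4 → ℤ)), (∃ y : Fin 4 → ℤ, y 0 * c 1 - y 1 * c 0 + y 2 * c 3 - y 3 * c 2 = 1) → γ 0 * c 1 - γ 1 * c 0 + γ 2 * c 3 - γ 3 * c 2 = 0 → Submodule.span ℤ ({c, γ} ∪ Set.range cs) = ⊤ → Ideal.span (Set.range (fun i : Fin 4 => (cs i) 0 * c 1 - (cs i) 1 * c 0 + (cs i) 2 * c 3 - (cs i) 3 * c 2)) = ⊤ := by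
  intro c γ cs hy hγ hspan
  obtain ⟨y, hy⟩ := hy
  set I : Ideal ℤ := Ideal.span
    (Set.range (fun i : Fin 4 => (cs i) 0 * c 1 - (cs i) 1 * c 0 + (cs i) 2 * c 3 - (cs i) 3 * c 2))
  -- the functional `x ↦ ω(x, c)` maps the span of `c, γ, cs i` into `I`
  have key : ∀ x ∈ Submodule.span ℤ ({c, γ} ∪ Set.range cs),
      x 0 * c 1 - x 1 * c 0 + x 2 * c 3 - x 3 * c 2 ∈ I := by
    intro x hx
    induction hx using Submodule.span_induction with
    | mem x hx =>
      rcases hx with hx | ⟨i, rfl⟩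
      · simp only [Set.mem_insert_iff, Set.mem_singleton_iff] at hx
        rcases hx with h | h
        · have h0 : c 0 * c 1 - c 1 * c 0 + c 2 * c 3 - c 3 * c 2 = 0 := by ring
          rw [h, h0]
          exact I.zero_mem
        · rw [h, hγ]
          exact I.zero_mem
      · exact Ideal.subset_span ⟨i, rfl⟩
    | zero => simp
    | add x z _ _ hx hz =>
      have h : (x + z) 0 * c 1 - (x + z) 1 * c 0 + (x + z) 2 * c 3 - (x + z) 3 * c 2
          = (x 0 * c 1 - x 1 * c 0 + x 2 * c 3 - x 3 * c 2)
            + (z 0 * c 1 - z 1 * c 0 + z 2 * c 3 - z 3 * c 2) := by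
        simp only [Pi.add_apply]
        ring
      rw [h]
      exact I.add_mem hx hz
    | smul a x _ hx =>
      have h : (a • x) 0 * c 1 - (a • x) 1 * c 0 + (a • x) 2 * c 3 - (a • x) 3 * c 2
          = a * (x 0 * c 1 - x 1 * c 0 + x 2 * c 3 - x 3 * c 2) := by
        simp only [Pi.smul_apply, smul_eq_mul]
        ring
      rw [h]
      exact I.mul_mem_left a hx
  have hymem : y ∈ Submodule.span ℤ ({c, γ} ∪ Set.range cs) := by
    rw [hspan]
    exact Submodule.mem_top
  have h1 : (1 : ℤ) ∈ I := hy ▸ key y hymem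
  exact (Ideal.eq_top_iff_one I).mpr h1

end Summit.SmoothPoincare4.SmoothPoincare4.Theorems
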